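import Mathlib.Analysis.SpecialFunctions.Trigonometric.Arctan
import Literature.Computability.Cryptography.QuantumTuringMachine
import HarnessLib

/-!
# Elementary transcendental functions preserve polynomial-time computability of reals
# (Brent 1976; Weihrauch 2000, Thm. 7.3.18) — named fact

Sibling of `PolyTimeComputableReals.lean` / `PolyTimeComputableRealsSqrt.lean` (ring, field and
square-root closure of the polynomial-time computable reals `IsPolyTimeComputableReal`, Ko 1991
Def. 2.1, defined in `QuantumTuringMachine.lean`). This file records, as a NAMED FACT (D-0014), the
one closure property those files do not prove: `exp`, `sin`, `cos`, `arctan` map polynomial-time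
computable reals to polynomial-time computable reals.

Vendored by a grounder for route `QuantumAdvantage/YangBaxterIslands`: the entries of the XXZ gate
`cos 2aπ`, `sin 2aπ`, `e^{±ibπ}` (`a, b ∈ ℚ`) must be polynomial-time computable both for
`YbMembership` (`XXZBQP ⊆ BQP` via the tree's effective Solovay–Kitaev compiler
`EffectiveCompilation.lean`, whose hypotheses ask for `IsPolyTimeComputableComplex` entries) and
for `YbFreeFermionLine` (via `Matchgate.JozsaMiyake2008_thm1`); with
`Complexity.MachinPiFP.isPolyTimeComputableReal_pi`, `IsPolyTimeComputableReal.ratCast'/.mul` and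
`IsPolyTimeComputableComplex.exp_mul_I` (from `cos θ`, `sin θ`) this fact closes that gap. The tree
so far has only the ad hoc radicals `cos (π/5)`, `cos (π/10)` (`JonesGateEntriesPolyTime.lean`) and
`cos (jθ)` from `cos θ`.

## Source, as printed, and how the vendored statement is assembled from it

K. Weihrauch, *Computable Analysis*, Springer 2000, **Theorem 7.3.18** (complexity of
transcendental functions) [Bre76]: "On compact subsets of their domains the real functions exp,
sin, cos, tan and their inverses can be computed in time `t_m(k) · log k`" (`t_m` a regular time
bound for integer multiplication, so `t_m(k) log k` is polynomial), attributed to R. P. Brent,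
*Fast multiple-precision evaluation of elementary functions*, J. ACM 23 (1976) 242–251. This is a
statement about real FUNCTIONS in the Type-2 (signed-digit) model, Definition 7.2.6(1). The
NUMBER-level corollary recorded below is assembled from it by three printed bookkeeping facts of the
same book: Definition 7.2.6(2) ("a real number `a` is computable in time `t` iff the constant
function `() ↦ a` is computable in time `t`"), Corollary 7.2.13(4) ("the class of real functions
computable in polynomial time is closed under composition" — compose `() ↦ x` with `exp`/`sin`/…
on the compact set `{x}`), and the equivalence of the Type-2 polynomial-time notion with Ko's
oracle/dyadic-approximation definition (Theorem 9.4.3(2), with Example 7.2.14(2)–(3) for numbers: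
"`x` is computable in time `t` iff there is a word function `h` computable in time `t` with
`|x − ν_ℚ(h(0^k))| ≤ 2^{-k}`", which for polynomial `t` is exactly the tree's
`IsPolyTimeComputableReal`: a dyadic `f n / 2ⁿ` within `2⁻ⁿ`, computed from `1ⁿ` in polynomial
time). Ko 1991, *Complexity Theory of Real Functions*, §2 proves the same closure directly in the
oracle model. Nothing here is stronger than print; `tan`, `log`, `arcsin`, `arccos` (partial
functions) are omitted.

## Not here

Function-level (uniform) polynomial-time computability of `exp`/`sin`/`cos` as maps (the tree has
no Type-2 / oracle-machine notion of real-function complexity), the `t_m(k) log k` bound itself, and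
any discharge (a discharge would run the Taylor series with rigorous remainder inside `FP`, as
`MachinPiFP.lean` does for `π`).
-/

namespace Literature.Computability.Cryptography

/-- **Elementary transcendental functions of a polynomial-time computable real are polynomial-time
computable** (Brent 1976; Weihrauch 2000, Thm. 7.3.18, number-level corollary via Def. 7.2.6(2),
Cor. 7.2.13(4) and Thm. 9.4.3(2) / Example 7.2.14(3); Ko 1991 §2): if `x : ℝ` has dyadic
`2⁻ⁿ`-approximations computable from `1ⁿ` in polynomial time (`IsPolyTimeComputableReal x`), then so
do `exp x`, `sin x`, `cos x` and `arctan x`. As printed (Weihrauch 2000, Thm. 7.3.18 [Bre76]): "On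
compact subsets of their domains the real functions exp, sin, cos, tan and their inverses can be
computed in time `t_m(k) · log k`." Typical use: `cos (qπ)`, `sin (qπ)` for `q : ℚ` (with
`isPolyTimeComputableReal_pi`, `.ratCast'`, `.mul`), hence `IsPolyTimeComputableComplex (exp (qπ i))`
by `IsPolyTimeComputableComplex.exp_mul_I` — the gate entries of Clifford-cyclotomic, Jones and XXZ
gate sets. [cite: Weihrauch2000, Thm 7.3.18] -/
def Weihrauch2000_thm7318 : Prop :=
  ∀ x : ℝ, IsPolyTimeComputableReal x →
    IsPolyTimeComputableReal (Real.exp x) ∧ IsPolyTimeComputableReal (Real.sin x) ∧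
      IsPolyTimeComputableReal (Real.cos x) ∧ IsPolyTimeComputableReal (Real.arctan x)

/-- The cosine clause of `Weihrauch2000_thm7318`, for a hypothesis `h : Weihrauch2000_thm7318`.
[cite: Weihrauch2000, Thm 7.3.18] -/
theorem Weihrauch2000_thm7318.cos (h : Weihrauch2000_thm7318) {x : ℝ}
    (hx : IsPolyTimeComputableReal x) : IsPolyTimeComputableReal (Real.cos x) :=
  (h x hx).2.2.1

/-- The sine clause of `Weihrauch2000_thm7318`, for a hypothesis `h : Weihrauch2000_thm7318`.
[cite: Weihrauch2000, Thm 7.3.18] -/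
theorem Weihrauch2000_thm7318.sin (h : Weihrauch2000_thm7318) {x : ℝ}
    (hx : IsPolyTimeComputableReal x) : IsPolyTimeComputableReal (Real.sin x) :=
  (h x hx).2.1

/-- The exponential clause of `Weihrauch2000_thm7318`, for a hypothesis `h : Weihrauch2000_thm7318`.
[cite: Weihrauch2000, Thm 7.3.18] -/
theorem Weihrauch2000_thm7318.exp (h : Weihrauch2000_thm7318) {x : ℝ}
    (hx : IsPolyTimeComputableReal x) : IsPolyTimeComputableReal (Real.exp x) :=
  (h x hx).1

end Literature.Computability.Cryptography
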